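/-
Copyright (c) 2026. All rights reserved.
Released under Apache 2.0 license as described in the file LICENSE.
Authors: abc-iut cell, seat abc-iut-w5-d226 (gen 3; the consumer closer of GAP G-w5d226-2 «G-P13-GR»).
-/
import Literature.AnabelianGeometry.AbsoluteAnabelian.AbsTopII.DPSCDataOfEmbedding
import Literature.AnabelianGeometry.AbsoluteAnabelian.ProfiniteOuterSemidirectProductConj
import Literature.AnabelianGeometry.SemiGraphs.PSCGraphicInner
import HarnessLib

/-!
# [AbsTopII] Def 1.2 (ii) / Prop 1.3: the DPSC-extension `Π_𝒢 ⋊^out H` of PSC construction data, CONSTRUCTED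

S. Mochizuki, *Topics in Absolute Anabelian Geometry II* [AbsTopII] (bib `MochizukiAbsTopII2013`; kurims
manuscript `paper:url-585b8d0ad0d9`), §1 Def 1.2 (ii) p. 10: "Let `ρ_H : H → Aut(𝒢) (⊆ Out(Π_𝒢))` be a
continuous homomorphism of profinite groups; `ι : I ↪ H` a continuous injection … with normal image … we
shall refer to … `1 → Π_𝒢 → Π_H := (Π_𝒢 ⋊^out H) → H → 1` … as the DPSC-extension associated to the
construction data", "`Π_I := Π_𝒢 ⋊^out I = Π_H ×_H I`"; Prop 1.3 pp. 11–12.  [SemiAnbd] §0 p. 5 (outer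
semi-direct products); [CombGC] Def 1.1 (ii), Prop 1.2, Def 1.4 (i).

GAP row G-w5d226-2 «G-P13-GR» (plan/GAP-LEDGER.md) asked for `Π_𝒢 ⋊^out H` AS A PROFINITE GROUP; it was
delivered by abc-iut-w5-d151 (`ProfiniteAutGroup*`, `ProfiniteOuterSemidirectProduct(Conj).lean`:
`outerSemidirectProfinite hG θ : ProfiniteGrp`, closed embedding `inlProfinite`, open surjection
`sndProfinite`, conjugation = `Aut`-component `inlProfinite_conjAutOf`, outer class `mk_autComponent`) with
abc-iut-L3-d5 (`SemiGraphs/OuterSemidirectProductProfinite.lean`).  This file is the CONSUMER CLOSER: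

* ONE definition `DPSCData.ofOuterAction G hG θ I` := `DPSCData.ofEmbedding` at `E := Π_𝒢 ⋊^out_θ J`,
  `ι := inl`, `Π_I := snd⁻¹(I)` — the DPSC data of the construction data (PSC datum `G` on the profinite,
  topologically finitely generated, centre-free `Π_𝒢`; continuous outer action `θ : J → Out(Π_𝒢)`;
  inertia `I ⊴ J`);
* `isGraphic_conjAutOf_of_lifts` — "`ρ_H` takes values in `Aut(𝒢)`" in kernel form: if every outer
  class `θ j` has ONE graphic lift, then the `Aut`-component of EVERY element of `Π_𝒢 ⋊^out J` is graphic
  ([CombGC] Def 1.4 (i) is insensitive to inner automorphisms: `PSCGraphicInner.lean`);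
* `prop13vi_ofOuterAction` — **[AbsTopII] Prop 1.3 (vi) AS TYPED (F-0279) for the constructed
  DPSC-extension from: graphic lifts of `θ`, [CombGC] Prop 1.2 (ii) for `G`, [CombGC] Prop 1.2 (i) for `G`**;
  `prop13vii/v/ix/iii_ofOuterAction` likewise with their named geometric residues.

HONEST FRAMING: the construction is classical ([SemiAnbd] §0); the hypotheses left are NAMED — [CombGC]
Prop 1.2 (i)(ii) at `G` (printed facts F-0459/F-0438 for PSC-type data), graphic lifts of `θ` (the content
of "`Aut(𝒢) ⊆ Out(Π_𝒢)`"), [CombGC] Rmk 1.1.3 slimness, and the Prop 1.3 (i)–(iv) log-structure clauses;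
typed ≠ proved; nothing here bears on [IUTchIII] Cor 3.12 or takes a side on any author.
-/

noncomputable section

open scoped Pointwise

namespace Literature.AnabelianGeometry.AbsoluteAnabelian

open Literature.AlgebraicGeometry.Frobenioids (IsSlimGroup)
open Literature.AnabelianGeometry.EtaleTheta (contMulAut mem_contMulAut TopOut innerContAut innerAut)
open Literature.AnabelianGeometry.SemiGraphs
open Topology

universe u

namespace DPSCData

variable {P : Type u} [Group P] [TopologicalSpace P] [IsTopologicalGroup P] [CompactSpace P]
  [TotallyDisconnectedSpace P] (G : PSCDatum P) (hG : IsTopologicallyFinitelyGenerated P)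
  (hZ : Subgroup.center P = ⊥)
  {J : Type u} [Group J] [TopologicalSpace J] [IsTopologicalGroup J] [CompactSpace J]
  [TotallyDisconnectedSpace J] (θ : J →ₜ* outProfinite hG) (I : Subgroup J) [I.Normal]

omit [I.Normal] in
/-- `Π_𝔾 = inl(Π_𝒢) ⊆ snd⁻¹(I) = Π_I`. [cite: MochizukiAbsTopII2013, Def 1.2 (ii) p.10] -/
theorem range_inl_le_comap_snd :
    (inlProfinite hG θ).toMonoidHom.range ≤ I.comap (sndProfinite hG θ).toMonoidHom := by
  rw [range_inlProfinite_eq_ker, ← MonoidHom.comap_bot]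
  exact Subgroup.comap_mono bot_le

/-- **[AbsTopII] Def 1.2 (ii): the DPSC data of the construction data** (`𝒢` = the PSC datum `G` on the
profinite, topologically finitely generated, centre-free `Π_𝒢`; `ρ_H = θ : J → Out(Π_𝒢)` continuous;
inertia subgroup `I ⊴ J`): `Π_H := Π_𝒢 ⋊^out_θ J` (abc-iut-w5-d151's `outerSemidirectProfinite`),
`Π_𝔾 := inl(Π_𝒢)`, `Π_I := Π_H ×_J I = snd⁻¹(I)`, and `Π_v, Π_e` = `inl` of `G`'s representatives.
[cite: MochizukiAbsTopII2013, Def 1.2 (ii) p.10] -/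
def ofOuterAction : DPSCData.{u} :=
  ofEmbedding G (outerSemidirectProfinite hG θ) (inlProfinite hG θ).toMonoidHom
    (isClosed_range_inlProfinite hG θ) (range_inlProfinite_normal hG θ)
    (I.comap (sndProfinite hG θ).toMonoidHom) inferInstance (range_inl_le_comap_snd hG θ I)

/-- `ofOuterAction` unfolds to `ofEmbedding`. [cite: MochizukiAbsTopII2013, Def 1.2 (ii) p.10] -/
theorem ofOuterAction_eq :
    ofOuterAction G hG θ I = ofEmbedding G (outerSemidirectProfinite hG θ) (inlProfinite hG θ).toMonoidHom
      (isClosed_range_inlProfinite hG θ) (range_inlProfinite_normal hG θ)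
      (I.comap (sndProfinite hG θ).toMonoidHom) inferInstance (range_inl_le_comap_snd hG θ I) := rfl

/-! ### "`ρ_H : H → Aut(𝒢) ⊆ Out(Π_𝒢)`": graphic lifts -/

/-- **Graphicity of the conjugation action from graphic LIFTS of the outer action** ([AbsTopII] Def 1.2
(ii) "`Aut(𝒢) ⊆ Out(Π_𝒢)`"): if every outer class `θ j` has one graphic lift `φ_j`, then the
`Aut`-component of every `h ∈ Π_𝒢 ⋊^out J` (which represents `θ (snd h)`, `mk_autComponent`) is graphic —
it differs from `φ_{snd h}` by an inner automorphism, and graphicity is insensitive to inner automorphisms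
(`PSCDatum.IsGraphic.of_conj_comp`). [cite: MochizukiAbsTopII2013, Def 1.2 (ii) p.10]
[cite: MochizukiCombGC2007, Def 1.4(i) p.10] -/
theorem isGraphic_conjAutOf_of_lifts
    (hθ : ∀ j : J, ∃ φ : P ≃ₜ* P,
      TopOut.mk P ⟨φ.toMulEquiv, (mem_contMulAut P).mpr ⟨φ.continuous, φ.symm.continuous⟩⟩ =
        outerActionOfContinuous hG θ j ∧ G.IsGraphic G φ)
    (h : outerSemidirectProfinite hG θ) : G.IsGraphic G (conjAutOf hG θ h) := by
  obtain ⟨φ, hφ, hgr⟩ := hθ h.1.2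
  set c : contMulAut P := ⟨φ.toMulEquiv, (mem_contMulAut P).mpr ⟨φ.continuous, φ.symm.continuous⟩⟩ with hc
  -- the `Aut`-component of `h` and `φ` have the same outer class
  have hclass : TopOut.mk P (autComponent hG θ h) = TopOut.mk P c := by
    rw [mk_autComponent, hφ]
  -- hence they differ by an inner automorphism: `c⁻¹ * autComponent h = conj p`
  have hmem : c⁻¹ * autComponent hG θ h ∈ innerContAut P := by
    rw [← QuotientGroup.eq]
    exact hclass.symm
  obtain ⟨p, hp⟩ : ∃ p : P, MulAut.conj p = ((c⁻¹ * autComponent hG θ h : contMulAut P) : MulAut P) :=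
    Subgroup.mem_subgroupOf.mp hmem
  have hmul : (c : MulAut P) * MulAut.conj p = (autComponent hG θ h : MulAut P) := by
    rw [hp, Subgroup.coe_mul, InvMemClass.coe_inv, mul_inv_cancel_left]
  have hconj : ∀ x, conjAutOf hG θ h x = φ p * φ x * (φ p)⁻¹ := by
    intro x
    have hx := congrArg (fun ψ : MulAut P => ψ x) hmul
    simp only [MulAut.mul_apply, MulAut.conj_apply] at hx
    rw [conjAutOf_apply, ← hx]
    change φ (p * x * p⁻¹) = _
    rw [map_mul, map_mul, map_inv]
  exact hgr.of_conj_comp (φ p) (conjAutOf hG θ h) hconj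

/-- The bridge's conjugation hypothesis `hconj` for the constructed extension.
[cite: MochizukiAbsTopII2013, Def 1.2 (ii) p.10] -/
theorem hconj_ofOuterAction (hgraphic : ∀ h : outerSemidirectProfinite hG θ, G.IsGraphic G (conjAutOf hG θ h)) :
    ∀ h : outerSemidirectProfinite hG θ, ∃ φ : P ≃ₜ* P,
      (∀ x, h * (inlProfinite hG θ).toMonoidHom x * h⁻¹ = (inlProfinite hG θ).toMonoidHom (φ x)) ∧
        G.IsGraphic G φ :=
  fun h => ⟨conjAutOf hG θ h, fun x => (inlProfinite_conjAutOf hG θ h x).symm, hgraphic h⟩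

/-! ### [AbsTopII] Prop 1.3 for the constructed DPSC-extension -/

include hZ

/-- **[AbsTopII] Prop 1.3 (vi) AS TYPED (F-0279) for the CONSTRUCTED DPSC-extension `Π_𝒢 ⋊^out_θ J`**
from: (1) the `Aut`-component of every element is graphic (⇐ graphic lifts of `θ`,
`isGraphic_conjAutOf_of_lifts`), (2) [CombGC] Prop 1.2 (ii) for `G`, (3) [CombGC] Prop 1.2 (i) for `G`.
[cite: MochizukiAbsTopII2013, Prop 1.3 (vi) p.12] [cite: MochizukiCombGC2007, Prop 1.2 p.8] -/
theorem prop13vi_ofOuterAction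
    (hgraphic : ∀ h : outerSemidirectProfinite hG θ, G.IsGraphic G (conjAutOf hG θ h))
    (hCT : G.VerticialEdgeLikeCommensurablyTerminal) (hDetV : G.VerticialOpenInterDeterminesVertex) :
    (ofOuterAction G hG θ I).Prop13vi :=
  prop13vi_ofEmbedding G _ _ (inlProfinite hG θ).continuous (inlProfinite_injective hG θ hZ) _ _ _ _ _
    (hconj_ofOuterAction G hG θ hgraphic) hCT hDetV

/-- **[AbsTopII] Prop 1.3 (vi) (F-0279) for `Π_𝒢 ⋊^out_θ J` from graphic LIFTS of `θ` and [CombGC] Prop 1.2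
(i)(ii) for `G`.** [cite: MochizukiAbsTopII2013, Prop 1.3 (vi) p.12] [cite: MochizukiCombGC2007, Prop 1.2 p.8] -/
theorem prop13vi_ofOuterAction_of_lifts
    (hθ : ∀ j : J, ∃ φ : P ≃ₜ* P,
      TopOut.mk P ⟨φ.toMulEquiv, (mem_contMulAut P).mpr ⟨φ.continuous, φ.symm.continuous⟩⟩ =
        outerActionOfContinuous hG θ j ∧ G.IsGraphic G φ)
    (hCT : G.VerticialEdgeLikeCommensurablyTerminal) (hDetV : G.VerticialOpenInterDeterminesVertex) :
    (ofOuterAction G hG θ I).Prop13vi :=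
  prop13vi_ofOuterAction G hG hZ θ I (isGraphic_conjAutOf_of_lifts G hG θ hθ) hCT hDetV

/-- **[AbsTopII] Prop 1.3 (vii) AS TYPED (F-0280) for `Π_𝒢 ⋊^out_θ J`** from graphicity, [CombGC] Prop 1.2
(i)(ii) for `G` and the Prop 1.3 (ii) clauses (`hii`, geometric).
[cite: MochizukiAbsTopII2013, Prop 1.3 (vii) p.12] [cite: MochizukiCombGC2007, Prop 1.2 p.8] -/
theorem prop13vii_ofOuterAction
    (hgraphic : ∀ h : outerSemidirectProfinite hG θ, G.IsGraphic G (conjAutOf hG θ h))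
    (hCT : G.VerticialEdgeLikeCommensurablyTerminal) (hDet : G.EdgeLikeOpenInterDeterminesEdge)
    (hii : ∀ n, (ofOuterAction G hG θ I).nodeSub n ≤ (ofOuterAction G hG θ I).IvNode n ∧
      (ofOuterAction G hG θ I).IvNode n ⊔ (ofOuterAction G hG θ I).PiG = (ofOuterAction G hG θ I).PiI) :
    (ofOuterAction G hG θ I).Prop13vii :=
  prop13vii_ofEmbedding G _ _ (inlProfinite hG θ).continuous (inlProfinite_injective hG θ hZ) _ _ _ _ _
    (hconj_ofOuterAction G hG θ hgraphic) hCT hDet hii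

/-- **[AbsTopII] Prop 1.3 (v) (outer clauses) AS TYPED (F-0278) for `Π_𝒢 ⋊^out_θ J`** from graphicity,
[CombGC] Prop 1.2 (i)(ii) for `G`, "(iv) at open subgroups" and "`I_v` infinite".
[cite: MochizukiAbsTopII2013, Prop 1.3 (v) p.12] [cite: MochizukiCombGC2007, Prop 1.2 p.8] -/
theorem prop13v_ofOuterAction
    (hgraphic : ∀ h : outerSemidirectProfinite hG θ, G.IsGraphic G (conjAutOf hG θ h))
    (hCT : G.VerticialEdgeLikeCommensurablyTerminal) (hDetV : G.VerticialOpenInterDeterminesVertex)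
    (hL : ∀ (v : (ofOuterAction G hG θ I).Vert) (g : (ofOuterAction G hG θ I).PiH),
      (ofOuterAction G hG θ I).Iv v ⊓ MulAut.conj g • (ofOuterAction G hG θ I).Iv v ≠ ⊥ →
        MulAut.conj g • (ofOuterAction G hG θ I).vertSub v = (ofOuterAction G hG θ I).vertSub v)
    (hinf : ∀ v, Infinite ↥((ofOuterAction G hG θ I).Iv v)) :
    (ofOuterAction G hG θ I).Prop13v :=
  prop13v_ofEmbedding G _ _ (inlProfinite hG θ).continuous (inlProfinite_injective hG θ hZ) _ _ _ _ _
    (hconj_ofOuterAction G hG θ hgraphic) hCT hDetV hL hinf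

/-- **[AbsTopII] Prop 1.3 (ix) AS TYPED (F-0277) for `Π_𝒢 ⋊^out_θ J`** from graphicity, [CombGC] Prop 1.2
(ii) for `G`, `Π_𝒢` slim nontrivial ([CombGC] Rmk 1.1.3 — named), `Π_e ≤ I_e`, `Π_e` abelian (cusps).
[cite: MochizukiAbsTopII2013, Prop 1.3 (ix) p.12] [cite: MochizukiCombGC2007, Prop 1.2 p.8] -/
theorem prop13ix_ofOuterAction [Nontrivial P] (hslim : IsSlimGroup P)
    (hgraphic : ∀ h : outerSemidirectProfinite hG θ, G.IsGraphic G (conjAutOf hG θ h))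
    (hCT : G.VerticialEdgeLikeCommensurablyTerminal)
    (hii : ∀ n, (ofOuterAction G hG θ I).nodeSub n ≤ (ofOuterAction G hG θ I).IvNode n)
    (hab : ∀ c, ∀ x ∈ (ofOuterAction G hG θ I).cuspSub c, ∀ y ∈ (ofOuterAction G hG θ I).cuspSub c,
      x * y = y * x) :
    (ofOuterAction G hG θ I).Prop13ix :=
  prop13ix_ofEmbedding G _ _ (inlProfinite hG θ).continuous (inlProfinite_injective hG θ hZ) _ _ _ _ _
    hslim (hconj_ofOuterAction G hG θ hgraphic) hCT hii hab

/-- **[AbsTopII] Prop 1.3 (iii), first clauses, AS TYPED (F-0275) for `Π_𝒢 ⋊^out_θ J`** from [CombGC]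
Prop 1.2 (ii) for `G`, slimness of `G`'s verticial subgroups ([CombGC] Rmk 1.1.3 — named) and "`I_v ↠ I`".
[cite: MochizukiAbsTopII2013, Prop 1.3 (iii) p.11] [cite: MochizukiCombGC2007, Prop 1.2 p.8] -/
theorem prop13iii_ofOuterAction
    (hCT : G.VerticialEdgeLikeCommensurablyTerminal) (hslimv : ∀ w, IsSlimGroup ↥(G.vertGp w))
    (hsurj : ∀ v, (ofOuterAction G hG θ I).Iv v ⊔ (ofOuterAction G hG θ I).PiG = (ofOuterAction G hG θ I).PiI) :
    (ofOuterAction G hG θ I).Prop13iii :=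
  prop13iii_ofEmbedding G _ _ (inlProfinite hG θ).continuous (inlProfinite_injective hG θ hZ) _ _ _ _ _
    hCT hslimv hsurj

end DPSCData

end Literature.AnabelianGeometry.AbsoluteAnabelian

end
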